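import Mathlib.Analysis.Polynomial.MahlerMeasure
import Mathlib.RingTheory.Polynomial.Resultant.Basic
import Mathlib.FieldTheory.Separable
import Mathlib.FieldTheory.IsAlgClosed.Basic
import Mathlib.Analysis.Complex.Polynomial.Basic
import Mathlib.LinearAlgebra.Vandermonde
import Literature.Analysis.Matrix.HadamardInequality
import HarnessLib

/-!
# Distance from a point to the nearest root of an integer polynomial (Bugeaud 2004, Lemma A.8)

Y. Bugeaud, *Approximation by Algebraic Numbers* (Cambridge Tracts in Math. 160, CUP 2004),
Appendix A.3 "Zeros of polynomials", **Lemma A.8** (PDF pp. 223–224; due to Diaz 1997 for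
`ℓ ≥ 2`, strengthening Lemma 5 of Laurent–Roy 1999): for a non-constant separable integer
polynomial `P` of degree `n`, `ξ ∈ ℂ` and `α` a root of `P` with `|ξ - α|` minimal,
(A.23) `(2|ξ-α|)^{ℓ(ℓ+1)/2} ≤ 2^{ℓn} (n-ℓ)^{(n-ℓ)/2} M(P)^{n-ℓ-1} |P(ξ)|^ℓ` for `1 ≤ ℓ < n`, and
(A.25) `|ξ - α|^{ℓ(ℓ+1)/2} ≤ 2^{ℓn} n^{n/2} M(P)ⁿ |P(ξ)|^ℓ` for every `ℓ ≥ 1` when `|P(ξ)| ≤ 1`.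
This is the lemma through which the proof of Bugeaud's Theorem 8.11 (Diaz's approximation
theorem, `ApproximationByAlgebraicNumbers.lean`) passes from a small value `|P_j(ξ)|` to a close
root; its "good dependence on `n` (essentially `nⁿ` instead of `2^{n²}`)" comes from Hadamard's
inequality applied to a Vandermonde determinant.

## What is proved (everything; no named facts)

We follow the printed proof (A.26)–(A.30) and prove the **squares** of (A.23)/(A.25) (to stay
with natural-number exponents), with two deviations that only weaken intermediate constants in
ways the final statement (A.25) absorbs:
* instead of `Disc(P) ∈ ℤ ∖ {0}` we use the resultant `Res(P, P') = ± a · Disc(P) ∈ ℤ ∖ {0}`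
  (Mathlib's `Polynomial.resultant`, `resultant_eq_prod_eval`, non-vanishing over `ℚ` from
  `Separable = IsCoprime P P'`), which gives `1 ≤ |a|^{2n-1} ∏_{i≠j} |αᵢ - αⱼ|` (one extra `|a|`),
  whence (A.23)² with `M(P)^{2m-1}` in place of `M(P)^{2m-2}` (`m = n - ℓ`) —
  `core_root_distance_bound`;
* the `ℓ` nearest roots are selected as a subset `T` (no total ordering of the roots is used):
  pairs inside `T` are bounded by `|αᵢ - αⱼ| · d_min ≤ 2 dᵢ dⱼ`, pairs `T × U` by `2 d_γ`, and the
  pairs inside `U = S ∖ T` by Hadamard (`Literature.Analysis.Matrix.norm_det_sq_le_of_entry_le`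
  on the Vandermonde matrix, (A.27)): `∏_{β≠γ ∈ U} |β-γ| ≤ mᵐ ∏_{β∈U} max(1,|β|)^{2(m-1)}`.
(A.25)² then follows in the three regimes `ℓ < n`, `ℓ ≥ n ≥ 2` (through the case `ℓ' = n-1`,
(A.30), and `|ξ-α|ⁿ ≤ |P(ξ)| ≤ 1`) and `n = 1` — `norm_sub_root_pow_le`.

## Contents
* `one_le_prod_norm_eval_derivative` — `1 ≤ |a|^{n-1} ∏ |P'(αᵢ)|` (resultant step).
* `exists_subset_card_eq_forall_le`, `prod_prod_erase_eq_prod_pow`, `prod_prod_erase_const` —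
  bookkeeping; `prod_prod_norm_sub_eq_norm_det_vandermonde_sq`, `prod_prod_norm_sub_le`,
  `prod_prod_erase_norm_sub_le` — the Vandermonde/Hadamard bound (A.27).
* `core_root_distance_bound` — (A.23)² (variant above) for abstract root data.
* `roots_data`, `norm_sub_root_pow_le` — Lemma A.8 (A.25)² for `P ∈ ℤ[X]`.

## References
* Y. Bugeaud, *Approximation by Algebraic Numbers*, CUP 2004, Lemma A.8 and Thm A.3. [Bugeaud2004]
* G. Diaz, *Une nouvelle propriété d'approximation diophantienne*, C. R. Acad. Sci. Paris 324
  (1997), 969–972.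
-/

namespace Literature.NumberTheory.DiophantineApproximation

open Polynomial Finset

/-- The image of an integer polynomial in `ℂ[X]` factors through `ℚ[X]`. [folklore] -/
theorem map_intCast_complex_eq_map_map (P : ℤ[X]) :
    P.map (Int.castRingHom ℂ) = (P.map (Int.castRingHom ℚ)).map (algebraMap ℚ ℂ) := by
  rw [Polynomial.map_map]
  congr 1

/-- **Discriminant step** (Bugeaud, proof of Lemma A.8, (A.26)–(A.28) with `Res(P, P')` in place
of `Disc(P)`): for an integer polynomial `P` of degree `n` whose image `p` in `ℂ[X]` is
separable, the resultant `Res(P, P')` is a non-zero integer, whence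
`1 ≤ ‖a‖ⁿ⁻¹ ∏_{p(β)=0} ‖p'(β)‖` (`a` the leading coefficient).
[cite: Bugeaud2004, Lemma A.8 proof] -/
theorem one_le_prod_norm_eval_derivative (P : ℤ[X])
    (hsep : (P.map (Int.castRingHom ℂ)).Separable) :
    1 ≤ ‖(P.map (Int.castRingHom ℂ)).leadingCoeff‖ ^ (P.natDegree - 1) *
      ((P.map (Int.castRingHom ℂ)).roots.map
        fun β => ‖(derivative (P.map (Int.castRingHom ℂ))).eval β‖).prod := by
  set p : ℂ[X] := P.map (Int.castRingHom ℂ) with hp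
  set r : ℤ := P.resultant (derivative P) P.natDegree (P.natDegree - 1) with hr
  have hinjC : Function.Injective (Int.castRingHom ℂ) := Int.cast_injective
  have hinjQ : Function.Injective (Int.castRingHom ℚ) := Int.cast_injective
  have hnp : p.natDegree = P.natDegree := natDegree_map_eq_of_injective hinjC P
  -- `r ≠ 0`, seen over `ℚ`
  have hr0 : r ≠ 0 := by
    intro h0
    have hqsep : (P.map (Int.castRingHom ℚ)).Separable := by
      rw [hp, map_intCast_complex_eq_map_map, separable_map] at hsep
      exact hsep
    have hres :
        (P.map (Int.castRingHom ℚ)).resultant (derivative (P.map (Int.castRingHom ℚ))) ≠ 0 :=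
      resultant_ne_zero _ _ hqsep
    have hnq : (P.map (Int.castRingHom ℚ)).natDegree = P.natDegree :=
      natDegree_map_eq_of_injective hinjQ P
    have : (P.map (Int.castRingHom ℚ)).resultant (derivative (P.map (Int.castRingHom ℚ))) =
        (Int.castRingHom ℚ) r := by
      rw [hr, ← resultant_map_map, natDegree_derivative, hnq, derivative_map]
    rw [this, h0, map_zero] at hres
    exact hres rfl
  -- its image in `ℂ` is `aⁿ⁻¹ ∏ p'(β)`
  have hsplit : p.Splits := IsAlgClosed.splits p
  have hrC : ((r : ℤ) : ℂ) = p.leadingCoeff ^ (P.natDegree - 1) *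
      (p.roots.map fun β => (derivative p).eval β).prod := by
    have h1 : (Int.castRingHom ℂ) r = p.resultant (derivative p) P.natDegree (P.natDegree - 1) := by
      rw [hr, ← resultant_map_map, derivative_map]
    have h2 := resultant_eq_prod_eval p (derivative p) (P.natDegree - 1)
      ((natDegree_derivative_le p).trans (by rw [hnp])) hsplit
    rw [hnp] at h2
    rw [eq_intCast] at h1
    rw [h1, h2]
  have hnorm : (1 : ℝ) ≤ ‖((r : ℤ) : ℂ)‖ := by
    rw [Complex.norm_intCast]
    exact_mod_cast Int.one_le_abs hr0
  calc (1 : ℝ) ≤ ‖((r : ℤ) : ℂ)‖ := hnorm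
    _ = _ := by
      rw [hrC, norm_mul, norm_pow]
      congr 1
      rw [show ‖(p.roots.map fun β => (derivative p).eval β).prod‖ =
          normHom ((p.roots.map fun β => (derivative p).eval β).prod) from rfl, map_multiset_prod,
        Multiset.map_map]
      rfl

/-! ### Finite-product bookkeeping -/

/-- Selecting the `ℓ` smallest elements of a finite set for a real key `d`: a subset `T` of
cardinality `ℓ` with `d β ≤ d γ` whenever `β ∈ T`, `γ ∉ T`. [folklore] -/
theorem exists_subset_card_eq_forall_le {α : Type*} [DecidableEq α] (S : Finset α) (d : α → ℝ)
    (ℓ : ℕ) (hℓ : ℓ ≤ S.card) :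
    ∃ T ⊆ S, T.card = ℓ ∧ ∀ β ∈ T, ∀ γ ∈ S \ T, d β ≤ d γ := by
  induction ℓ with
  | zero => exact ⟨∅, Finset.empty_subset _, rfl, by simp⟩
  | succ k ih =>
    obtain ⟨T, hTS, hTc, hT⟩ := ih (Nat.le_of_succ_le hℓ)
    have hne : (S \ T).Nonempty := by
      rw [← Finset.card_pos, Finset.card_sdiff_of_subset hTS]; omega
    obtain ⟨β₀, hβ₀, hmin⟩ := Finset.exists_min_image (S \ T) d hne
    have hβ₀S : β₀ ∈ S := (Finset.mem_sdiff.1 hβ₀).1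
    have hβ₀T : β₀ ∉ T := (Finset.mem_sdiff.1 hβ₀).2
    refine ⟨insert β₀ T, Finset.insert_subset hβ₀S hTS,
      by rw [Finset.card_insert_of_notMem hβ₀T, hTc], fun β hβ γ hγ => ?_⟩
    have hγ' : γ ∈ S \ T := by
      rw [Finset.mem_sdiff] at hγ ⊢
      exact ⟨hγ.1, fun h => hγ.2 (Finset.mem_insert_of_mem h)⟩
    rcases Finset.mem_insert.1 hβ with rfl | hβT
    · exact hmin γ hγ'
    · exact hT β hβT γ hγ'

/-- `∏_{β ∈ T} ∏_{γ ∈ T ∖ {β}} f γ = ∏_{β ∈ T} (f β)^{|T| - 1}` (each `γ` is counted once for every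
`β ≠ γ`). [folklore] -/
theorem prod_prod_erase_eq_prod_pow {α : Type*} [DecidableEq α] (T : Finset α) (f : α → ℝ) :
    ∏ β ∈ T, ∏ γ ∈ T.erase β, f γ = ∏ β ∈ T, f β ^ (T.card - 1) := by
  rw [Finset.prod_comm' (t' := T) (s' := fun γ => T.erase γ)]
  · refine Finset.prod_congr rfl fun γ hγ => ?_
    rw [Finset.prod_const, Finset.card_erase_of_mem hγ]
  · intro β γ
    simp only [Finset.mem_erase]
    tauto

/-- The number of ordered pairs: `∏_{β ∈ T} ∏_{γ ∈ T ∖ {β}} c = c ^ (|T| (|T| - 1))`. [folklore] -/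
theorem prod_prod_erase_const {α : Type*} [DecidableEq α] (T : Finset α) (c : ℝ) :
    ∏ β ∈ T, ∏ _γ ∈ T.erase β, c = c ^ (T.card * (T.card - 1)) := by
  calc ∏ β ∈ T, ∏ _γ ∈ T.erase β, c = ∏ β ∈ T, c ^ (T.card - 1) :=
        Finset.prod_congr rfl fun β hβ => by rw [Finset.prod_const, Finset.card_erase_of_mem hβ]
    _ = c ^ (T.card * (T.card - 1)) := by rw [Finset.prod_const, ← pow_mul, mul_comm]

/-! ### The Vandermonde product of a finite set of complex numbers (Hadamard) -/

/-- `∏_{i} ∏_{j ≠ i} ‖vᵢ - vⱼ‖ = ‖det V(v)‖²` for the Vandermonde matrix. [folklore] -/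
theorem prod_prod_norm_sub_eq_norm_det_vandermonde_sq {m : ℕ} (v : Fin m → ℂ) :
    ∏ i, ∏ j ∈ univ.erase i, ‖v i - v j‖ = ‖(Matrix.vandermonde v).det‖ ^ 2 := by
  rw [Matrix.det_vandermonde, norm_prod, ← Finset.prod_pow]
  simp_rw [norm_prod, ← Finset.prod_pow]
  -- split `j ≠ i` into `j < i` and `i < j`
  have hsplit : ∀ i : Fin m, ∏ j ∈ univ.erase i, ‖v i - v j‖ =
      (∏ j ∈ Iio i, ‖v i - v j‖) * ∏ j ∈ Ioi i, ‖v i - v j‖ := by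
    intro i
    rw [← Finset.prod_union]
    · congr 1
      ext j
      simp only [Finset.mem_erase, Finset.mem_univ, and_true, Finset.mem_union, Finset.mem_Iio,
        Finset.mem_Ioi]
      exact ⟨fun h => lt_or_gt_of_ne h, fun h => h.elim ne_of_lt ne_of_gt⟩
    · rw [Finset.disjoint_left]
      intro j hj hj'
      exact lt_asymm (Finset.mem_Iio.1 hj) (Finset.mem_Ioi.1 hj')
  simp_rw [hsplit]
  rw [Finset.prod_mul_distrib]
  have hswap : ∏ i : Fin m, ∏ j ∈ Iio i, ‖v i - v j‖ = ∏ i : Fin m, ∏ j ∈ Ioi i, ‖v j - v i‖ := by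
    rw [Finset.prod_comm' (t' := univ) (s' := fun j => Ioi j)]
    intro i j
    simp
  rw [hswap, ← Finset.prod_mul_distrib]
  refine Finset.prod_congr rfl fun i _ => ?_
  rw [← Finset.prod_mul_distrib]
  refine Finset.prod_congr rfl fun j _ => ?_
  rw [norm_sub_rev (v i) (v j)]
  ring

/-- **Hadamard bound for the Vandermonde product**: for `m` complex numbers `v₁, …, vₘ`,
`∏_{i} ∏_{j ≠ i} ‖vᵢ - vⱼ‖ ≤ mᵐ ∏ᵢ max(1, ‖vᵢ‖)^{2(m-1)}` (Bugeaud, proof of Thm A.3 and of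
Lemma A.8, (A.27)). [cite: Bugeaud2004, Lemma A.8 proof (A.27)] -/
theorem prod_prod_norm_sub_le {m : ℕ} (v : Fin m → ℂ) :
    ∏ i, ∏ j ∈ univ.erase i, ‖v i - v j‖ ≤
      (m : ℝ) ^ m * ∏ i, max 1 ‖v i‖ ^ (2 * (m - 1)) := by
  rw [prod_prod_norm_sub_eq_norm_det_vandermonde_sq]
  have h := Literature.Analysis.Matrix.norm_det_sq_le_of_entry_le (Matrix.vandermonde v)
    (fun i => max 1 ‖v i‖ ^ (m - 1)) (fun i j => ?_)
  · refine h.trans (le_of_eq ?_)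
    rw [Finset.prod_mul_distrib, Finset.prod_const, Finset.card_univ, Fintype.card_fin]
    refine congrArg _ (Finset.prod_congr rfl fun i _ => ?_)
    rw [← pow_mul, mul_comm]
  · rw [Matrix.vandermonde_apply, norm_pow]
    calc ‖v i‖ ^ (j : ℕ) ≤ max 1 ‖v i‖ ^ (j : ℕ) :=
          pow_le_pow_left₀ (norm_nonneg _) (le_max_right _ _) _
      _ ≤ max 1 ‖v i‖ ^ (m - 1) :=
          pow_le_pow_right₀ (le_max_left _ _) (Nat.le_sub_one_of_lt j.isLt)

/-- Transfer of a product over a finite set of complex numbers to its enumeration by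
`Fin |U|`. [folklore] -/
theorem prod_eq_prod_fin_equivFin (U : Finset ℂ) (F : ℂ → ℝ) :
    ∏ β ∈ U, F β = ∏ i : Fin U.card, F ((U.equivFin.symm i : U) : ℂ) := by
  rw [← Finset.prod_coe_sort U]
  exact (Equiv.prod_comp U.equivFin.symm (fun x : U => F (x : ℂ))).symm

/-- **Hadamard bound for the root-difference product of a finite set** `U ⊂ ℂ` of size `m`:
`∏_{β ∈ U} ∏_{γ ∈ U ∖ {β}} ‖β - γ‖ ≤ mᵐ ∏_{β ∈ U} max(1, ‖β‖)^{2(m-1)}`.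
[cite: Bugeaud2004, Lemma A.8 proof (A.27)] -/
theorem prod_prod_erase_norm_sub_le (U : Finset ℂ) :
    ∏ β ∈ U, ∏ γ ∈ U.erase β, ‖β - γ‖ ≤
      (U.card : ℝ) ^ U.card * ∏ β ∈ U, max 1 ‖β‖ ^ (2 * (U.card - 1)) := by
  set v : Fin U.card → ℂ := fun i => ((U.equivFin.symm i : U) : ℂ) with hv
  have hvinj : Function.Injective v := fun i j h =>
    U.equivFin.symm.injective (Subtype.ext h)
  -- rewrite the double product through `ite`s and transfer it to `Fin |U|`
  have h1 : ∏ β ∈ U, ∏ γ ∈ U.erase β, ‖β - γ‖ =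
      ∏ β ∈ U, ∏ γ ∈ U, (if γ = β then (1 : ℝ) else ‖β - γ‖) := by
    refine Finset.prod_congr rfl fun β _ => ?_
    rw [← Finset.prod_erase U (a := β) (by simp)]
    exact Finset.prod_congr rfl fun γ hγ => by rw [if_neg (Finset.ne_of_mem_erase hγ)]
  have h2 : ∏ i : Fin U.card, ∏ j ∈ univ.erase i, ‖v i - v j‖ =
      ∏ i : Fin U.card, ∏ j : Fin U.card, (if v j = v i then (1 : ℝ) else ‖v i - v j‖) := by
    refine Finset.prod_congr rfl fun i _ => ?_
    rw [← Finset.prod_erase univ (a := i) (by simp)]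
    refine Finset.prod_congr rfl fun j hj => ?_
    rw [if_neg (fun h => Finset.ne_of_mem_erase hj (hvinj h))]
  have h3 : ∏ β ∈ U, ∏ γ ∈ U, (if γ = β then (1 : ℝ) else ‖β - γ‖) =
      ∏ i : Fin U.card, ∏ j : Fin U.card, (if v j = v i then (1 : ℝ) else ‖v i - v j‖) := by
    rw [prod_eq_prod_fin_equivFin]
    exact Finset.prod_congr rfl fun i _ => by rw [prod_eq_prod_fin_equivFin]
  rw [h1, h3, ← h2, prod_eq_prod_fin_equivFin]
  exact prod_prod_norm_sub_le v

/-- **Core of Bugeaud's Lemma A.8** ((A.26)–(A.29), squared, with `M(P)^{2m-1}` in place of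
`M(P)^{2m-2}` because the resultant `Res(P,P') = ± a · Disc(P)` is used instead of the
discriminant). Data: a finite set `S ⊂ ℂ` of `n` "roots", a "leading coefficient" `a` with
`‖a‖ ≥ 1`, the discriminant-type lower bound `1 ≤ ‖a‖^{2n-1} ∏_{β ≠ γ} ‖β - γ‖`, a point `ξ` and
a lower bound `dmin` for its distances to `S`. Conclusion, for `1 ≤ ℓ < n`, `m = n - ℓ`:
`(2 dmin)^{ℓ(ℓ+1)} ≤ 2^{2nℓ} mᵐ M^{2m-1} |P(ξ)|^{2ℓ}` where `M = ‖a‖ ∏ max(1,‖β‖)` and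
`|P(ξ)| = ‖a‖ ∏ ‖ξ - β‖`. [cite: Bugeaud2004, Lemma A.8 (A.23)] -/
theorem core_root_distance_bound (S : Finset ℂ) (a ξ : ℂ) (ha : 1 ≤ ‖a‖) (dmin : ℝ)
    (hdmin0 : 0 ≤ dmin) (hdmin : ∀ β ∈ S, dmin ≤ ‖ξ - β‖)
    (hD : 1 ≤ ‖a‖ ^ (2 * S.card - 1) * ∏ β ∈ S, ∏ γ ∈ S.erase β, ‖β - γ‖)
    (ℓ : ℕ) (hℓ : 1 ≤ ℓ) (hℓn : ℓ < S.card) :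
    dmin ^ (ℓ * (ℓ + 1)) * 2 ^ (ℓ * (ℓ + 1)) ≤
      2 ^ (2 * S.card * ℓ) * ((S.card - ℓ : ℕ) : ℝ) ^ (S.card - ℓ) *
        (‖a‖ * ∏ β ∈ S, max 1 ‖β‖) ^ (2 * (S.card - ℓ) - 1) *
        (‖a‖ * ∏ β ∈ S, ‖ξ - β‖) ^ (2 * ℓ) := by
  -- trivial when `dmin = 0`
  rcases hdmin0.eq_or_lt with h0 | hdpos
  · rw [← h0, zero_pow (by positivity), zero_mul]
    positivity
  -- notation
  set n := S.card with hn
  set m := n - ℓ with hm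
  have hm1 : 1 ≤ m := by omega
  have hnlm : n = ℓ + m := by omega
  set d : ℂ → ℝ := fun β => ‖ξ - β‖ with hd
  have hdpos' : ∀ β ∈ S, 0 < d β := fun β hβ => hdpos.trans_le (hdmin β hβ)
  -- the `ℓ` nearest roots
  obtain ⟨T, hTS, hTc, hT⟩ := exists_subset_card_eq_forall_le S d ℓ hℓn.le
  set U := S \ T with hU
  have hUc : U.card = m := by rw [hU, Finset.card_sdiff_of_subset hTS, ← hn, hTc]
  have hSU : S = T ∪ U := (Finset.union_sdiff_of_subset hTS).symm
  have hdisj : Disjoint T U := Finset.disjoint_sdiff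
  have hUS : U ⊆ S := Finset.sdiff_subset
  have heraseT : ∀ β ∈ T, S.erase β = T.erase β ∪ U := by
    intro β hβ
    ext γ
    simp only [Finset.mem_erase, Finset.mem_union, hU, Finset.mem_sdiff]
    constructor
    · rintro ⟨hne, hγS⟩
      by_cases hγT : γ ∈ T
      · exact Or.inl ⟨hne, hγT⟩
      · exact Or.inr ⟨hγS, hγT⟩
    · rintro (⟨hne, hγT⟩ | ⟨hγS, hγT⟩)
      · exact ⟨hne, hTS hγT⟩
      · exact ⟨fun h => hγT (h ▸ hβ), hγS⟩
  have heraseU : ∀ β ∈ U, S.erase β = T ∪ U.erase β := by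
    intro β hβ
    have hβT : β ∉ T := (Finset.mem_sdiff.1 hβ).2
    ext γ
    simp only [Finset.mem_erase, Finset.mem_union, hU, Finset.mem_sdiff]
    constructor
    · rintro ⟨hne, hγS⟩
      by_cases hγT : γ ∈ T
      · exact Or.inl hγT
      · exact Or.inr ⟨hne, hγS, hγT⟩
    · rintro (hγT | ⟨hne, hγS, hγT⟩)
      · exact ⟨fun h => hβT (h ▸ hγT), hTS hγT⟩
      · exact ⟨hne, hγS⟩
  -- the four blocks of the ordered-pair product
  set A11 := ∏ β ∈ T, ∏ γ ∈ T.erase β, ‖β - γ‖ with hA11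
  set A12 := ∏ β ∈ T, ∏ γ ∈ U, ‖β - γ‖ with hA12
  set A2 := ∏ β ∈ U, ∏ γ ∈ T, ‖β - γ‖ with hA2
  set DU := ∏ β ∈ U, ∏ γ ∈ U.erase β, ‖β - γ‖ with hDU
  have hsplit : ∏ β ∈ S, ∏ γ ∈ S.erase β, ‖β - γ‖ = A11 * A12 * (A2 * DU) := by
    rw [hSU, Finset.prod_union hdisj]
    congr 1
    · rw [hA11, hA12, ← Finset.prod_mul_distrib]
      refine Finset.prod_congr rfl fun β hβ => ?_
      rw [← hSU, heraseT β hβ,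
        Finset.prod_union (Finset.disjoint_of_subset_left (Finset.erase_subset _ _) hdisj)]
    · rw [hA2, hDU, ← Finset.prod_mul_distrib]
      refine Finset.prod_congr rfl fun β hβ => ?_
      rw [← hSU, heraseU β hβ,
        Finset.prod_union (Finset.disjoint_of_subset_right (Finset.erase_subset _ _) hdisj)]
  -- products of distances and of `max 1 ‖β‖`
  set DT := ∏ β ∈ T, d β with hDT
  set DUd := ∏ β ∈ U, d β with hDUd
  set MT := ∏ β ∈ T, max 1 ‖β‖ with hMT
  set MU := ∏ β ∈ U, max 1 ‖β‖ with hMU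
  have hDT0 : 0 < DT := Finset.prod_pos fun β hβ => hdpos' β (hTS hβ)
  have hDUd0 : 0 < DUd := Finset.prod_pos fun β hβ => hdpos' β (hUS hβ)
  have hMT1 : 1 ≤ MT := Finset.one_le_prod fun β _ => le_max_left _ _
  have hMU1 : 1 ≤ MU := Finset.one_le_prod fun β _ => le_max_left _ _
  have hPξ : ‖a‖ * ∏ β ∈ S, ‖ξ - β‖ = ‖a‖ * DT * DUd := by
    rw [hSU, Finset.prod_union hdisj, mul_assoc]
  have hM : ‖a‖ * ∏ β ∈ S, max 1 ‖β‖ = ‖a‖ * MT * MU := by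
    rw [hSU, Finset.prod_union hdisj, mul_assoc]
  set M := ‖a‖ * ∏ β ∈ S, max 1 ‖β‖ with hMdef
  have ha0 : 0 < ‖a‖ := one_pos.trans_le ha
  have hM1 : 1 ≤ M := by
    rw [hM]
    calc (1 : ℝ) = 1 * 1 * 1 := by ring
      _ ≤ ‖a‖ * MT * MU := by gcongr
  have haM : ‖a‖ ≤ M := by
    rw [hM]
    calc ‖a‖ = ‖a‖ * 1 * 1 := by ring
      _ ≤ ‖a‖ * MT * MU := by gcongr
  -- elementary distance bounds
  have htri : ∀ β γ : ℂ, ‖β - γ‖ ≤ d β + d γ := fun β γ => by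
    calc ‖β - γ‖ = ‖(ξ - γ) - (ξ - β)‖ := by congr 1; ring
      _ ≤ ‖ξ - γ‖ + ‖ξ - β‖ := norm_sub_le _ _
      _ = d β + d γ := by rw [hd]; ring
  -- (b1) pairs inside `T`
  have hb1 : A11 * dmin ^ (ℓ * (ℓ - 1)) ≤ 2 ^ (ℓ * (ℓ - 1)) * (DT ^ (ℓ - 1) * DT ^ (ℓ - 1)) := by
    have hpair : ∀ β ∈ T, ∀ γ ∈ T, ‖β - γ‖ * dmin ≤ 2 * (d β * d γ) := by
      intro β hβ γ hγ
      have hβ' := hdmin β (hTS hβ)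
      have hγ' := hdmin γ (hTS hγ)
      rcases le_total (d β) (d γ) with h | h
      · calc ‖β - γ‖ * dmin ≤ (d β + d γ) * dmin := by gcongr; exact htri β γ
          _ ≤ (d γ + d γ) * d β := by gcongr
          _ = 2 * (d β * d γ) := by ring
      · calc ‖β - γ‖ * dmin ≤ (d β + d γ) * dmin := by gcongr; exact htri β γ
          _ ≤ (d β + d β) * d γ := by gcongr
          _ = 2 * (d β * d γ) := by ring
    calc A11 * dmin ^ (ℓ * (ℓ - 1))
        = ∏ β ∈ T, ∏ γ ∈ T.erase β, (‖β - γ‖ * dmin) := by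
          rw [hA11, ← hTc, ← prod_prod_erase_const T dmin, ← Finset.prod_mul_distrib]
          exact Finset.prod_congr rfl fun β _ => by rw [Finset.prod_mul_distrib]
      _ ≤ ∏ β ∈ T, ∏ γ ∈ T.erase β, (2 * (d β * d γ)) := by
          apply Finset.prod_le_prod
          · intro β _; exact Finset.prod_nonneg fun γ _ => by positivity
          intro β hβ
          apply Finset.prod_le_prod
          · intro γ _; positivity
          intro γ hγ
          exact hpair β hβ γ (Finset.mem_of_mem_erase hγ)
      _ = 2 ^ (ℓ * (ℓ - 1)) * (DT ^ (ℓ - 1) * DT ^ (ℓ - 1)) := by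
          have e1 : ∏ β ∈ T, ∏ γ ∈ T.erase β, (2 * (d β * d γ)) =
              (∏ β ∈ T, ∏ _γ ∈ T.erase β, (2 : ℝ)) *
                ((∏ β ∈ T, ∏ _γ ∈ T.erase β, d β) * ∏ β ∈ T, ∏ γ ∈ T.erase β, d γ) := by
            rw [← Finset.prod_mul_distrib, ← Finset.prod_mul_distrib]
            refine Finset.prod_congr rfl fun β _ => ?_
            rw [← Finset.prod_mul_distrib, ← Finset.prod_mul_distrib]
          rw [e1, prod_prod_erase_const, hTc, prod_prod_erase_eq_prod_pow, hTc, hDT,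
            Finset.prod_pow]
          congr 2
          rw [← Finset.prod_pow]
          refine Finset.prod_congr rfl fun β hβ => ?_
          rw [Finset.prod_const, Finset.card_erase_of_mem hβ, hTc]
  -- (b2) pairs `T × U`
  have hb2 : A12 ≤ (2 ^ m * DUd) ^ ℓ := by
    calc A12 ≤ ∏ β ∈ T, ∏ γ ∈ U, 2 * d γ := by
          apply Finset.prod_le_prod
          · intro β _; exact Finset.prod_nonneg fun γ _ => by positivity
          intro β hβ
          apply Finset.prod_le_prod
          · intro γ _; positivity
          intro γ hγ
          calc ‖β - γ‖ ≤ d β + d γ := htri β γ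
            _ ≤ d γ + d γ := by gcongr; exact hT β hβ γ hγ
            _ = 2 * d γ := by ring
      _ = (2 ^ m * DUd) ^ ℓ := by
          rw [Finset.prod_const, hTc, Finset.prod_mul_distrib, Finset.prod_const, hUc]
  -- (b3) pairs `U × T`
  have hb3 : A2 ≤ 2 ^ (m * ℓ) * DUd ^ ℓ := by
    calc A2 ≤ ∏ β ∈ U, ∏ _γ ∈ T, 2 * d β := by
          apply Finset.prod_le_prod
          · intro β _; exact Finset.prod_nonneg fun γ _ => by positivity
          intro β hβ
          apply Finset.prod_le_prod
          · intro γ _; positivity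
          intro γ hγ
          calc ‖β - γ‖ ≤ d β + d γ := htri β γ
            _ ≤ d β + d β := by gcongr; exact hT γ hγ β hβ
            _ = 2 * d β := by ring
      _ = 2 ^ (m * ℓ) * DUd ^ ℓ := by
          simp_rw [Finset.prod_const, hTc]
          rw [Finset.prod_pow, Finset.prod_mul_distrib, Finset.prod_const, hUc, mul_pow, ← pow_mul]
  -- (b4) Hadamard on `U`
  have hb4 : ‖a‖ ^ (2 * (m - 1)) * DU ≤ (m : ℝ) ^ m * M ^ (2 * (m - 1)) := by
    have h := prod_prod_erase_norm_sub_le U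
    rw [hUc] at h
    calc ‖a‖ ^ (2 * (m - 1)) * DU ≤ ‖a‖ ^ (2 * (m - 1)) * ((m : ℝ) ^ m * MU ^ (2 * (m - 1))) := by
          gcongr
          rw [hMU, ← Finset.prod_pow]
          exact h
      _ = (m : ℝ) ^ m * (‖a‖ * MU) ^ (2 * (m - 1)) := by ring
      _ ≤ (m : ℝ) ^ m * M ^ (2 * (m - 1)) := by
          gcongr
          rw [hM]
          calc ‖a‖ * MU = ‖a‖ * 1 * MU := by ring
            _ ≤ ‖a‖ * MT * MU := by gcongr
  -- (b5) `dmin ^ ℓ ≤ DT`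
  have hb5 : dmin ^ ℓ ≤ DT := by
    rw [hDT, ← hTc, ← Finset.prod_const]
    exact Finset.prod_le_prod (fun _ _ => hdmin0) fun β hβ => hdmin β (hTS hβ)
  -- assembling
  have hexp2 : 2 * S.card * ℓ = ℓ * (ℓ - 1) + m * ℓ + m * ℓ + ℓ * (ℓ + 1) := by
    rw [← hn, hnlm]
    rcases Nat.exists_eq_add_of_le hℓ with ⟨k, rfl⟩
    simp only [Nat.add_sub_cancel_left]
    ring
  have hexpa : 2 * S.card - 1 = 2 * ℓ + 2 * (m - 1) + 1 := by omega
  have hexpd : ℓ * (ℓ + 1) = ℓ * (ℓ - 1) + 2 * ℓ := by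
    rcases Nat.exists_eq_add_of_le hℓ with ⟨k, rfl⟩
    simp only [Nat.add_sub_cancel_left]
    ring
  have hexpM : 2 * (S.card - ℓ) - 1 = 2 * (m - 1) + 1 := by omega
  have hA11nn : 0 ≤ A11 := Finset.prod_nonneg fun β _ => Finset.prod_nonneg fun γ _ => norm_nonneg _
  have hA12nn : 0 ≤ A12 := Finset.prod_nonneg fun β _ => Finset.prod_nonneg fun γ _ => norm_nonneg _
  have hA2nn : 0 ≤ A2 := Finset.prod_nonneg fun β _ => Finset.prod_nonneg fun γ _ => norm_nonneg _
  have hDUnn : 0 ≤ DU := Finset.prod_nonneg fun β _ => Finset.prod_nonneg fun γ _ => norm_nonneg _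
  have hDnn : 0 ≤ ∏ β ∈ S, ∏ γ ∈ S.erase β, ‖β - γ‖ :=
    Finset.prod_nonneg fun β _ => Finset.prod_nonneg fun γ _ => norm_nonneg _
  have key : dmin ^ (ℓ * (ℓ + 1)) ≤
      2 ^ (ℓ * (ℓ - 1) + m * ℓ + m * ℓ) * ((m : ℝ) ^ m * M ^ (2 * (m - 1)) * M) *
        (‖a‖ * DT * DUd) ^ (2 * ℓ) := by
    calc dmin ^ (ℓ * (ℓ + 1))
        = dmin ^ (ℓ * (ℓ - 1)) * (dmin ^ ℓ) ^ 2 * 1 := by rw [hexpd, pow_add, pow_mul]; ring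
      _ ≤ dmin ^ (ℓ * (ℓ - 1)) * (dmin ^ ℓ) ^ 2 *
            (‖a‖ ^ (2 * S.card - 1) * ∏ β ∈ S, ∏ γ ∈ S.erase β, ‖β - γ‖) := by gcongr
      _ = ‖a‖ ^ (2 * ℓ) * ‖a‖ * (A11 * dmin ^ (ℓ * (ℓ - 1))) * A12 * A2 *
            (‖a‖ ^ (2 * (m - 1)) * DU) * (dmin ^ ℓ) ^ 2 := by
          rw [hsplit, hexpa]; ring
      _ ≤ ‖a‖ ^ (2 * ℓ) * M * (2 ^ (ℓ * (ℓ - 1)) * (DT ^ (ℓ - 1) * DT ^ (ℓ - 1))) *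
            (2 ^ m * DUd) ^ ℓ * (2 ^ (m * ℓ) * DUd ^ ℓ) *
            ((m : ℝ) ^ m * M ^ (2 * (m - 1))) * DT ^ 2 := by
          gcongr
      _ = 2 ^ (ℓ * (ℓ - 1) + m * ℓ + m * ℓ) * ((m : ℝ) ^ m * M ^ (2 * (m - 1)) * M) *
            (‖a‖ ^ (2 * ℓ) * (DT ^ (ℓ - 1) * DT ^ (ℓ - 1) * DT ^ 2) * DUd ^ (2 * ℓ)) := by
          rw [pow_add, pow_add, mul_pow (2 ^ m) DUd ℓ, ← pow_mul]; ring
      _ = _ := by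
          have : DT ^ (ℓ - 1) * DT ^ (ℓ - 1) * DT ^ 2 = DT ^ (2 * ℓ) := by
            rw [← pow_add, ← pow_add]
            congr 1
            omega
          rw [this]; ring
  calc dmin ^ (ℓ * (ℓ + 1)) * 2 ^ (ℓ * (ℓ + 1))
      ≤ 2 ^ (ℓ * (ℓ - 1) + m * ℓ + m * ℓ) * ((m : ℝ) ^ m * M ^ (2 * (m - 1)) * M) *
        (‖a‖ * DT * DUd) ^ (2 * ℓ) * 2 ^ (ℓ * (ℓ + 1)) := by gcongr
    _ = _ := by
        rw [hexp2, hexpM, hPξ, pow_add _ (2 * (m - 1)) 1, pow_one, hm, hn]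
        ring

/-- The data of an integer polynomial seen in `ℂ[X]`: with `p = P_ℂ` separable of degree `n ≥ 1`,
`a` its leading coefficient and `S` its set of roots, one has `|S| = n`, `‖a‖ ≥ 1`,
`‖P(ξ)‖ = ‖a‖ ∏ ‖ξ - β‖`, `M(p) = ‖a‖ ∏ max(1, ‖β‖)` and the resultant bound
`1 ≤ ‖a‖^{2n-1} ∏_{β ≠ γ} ‖β - γ‖`. [cite: Bugeaud2004, Lemma A.8 proof] -/
theorem roots_data (P : ℤ[X]) (hn : 0 < P.natDegree)
    (hsep : (P.map (Int.castRingHom ℂ)).Separable) (ξ : ℂ) :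
    let p := P.map (Int.castRingHom ℂ)
    let S := p.roots.toFinset
    S.card = P.natDegree ∧ 1 ≤ ‖p.leadingCoeff‖ ∧
      (∀ β, β ∈ S ↔ β ∈ p.roots) ∧
      ‖aeval ξ P‖ = ‖p.leadingCoeff‖ * ∏ β ∈ S, ‖ξ - β‖ ∧
      p.mahlerMeasure = ‖p.leadingCoeff‖ * ∏ β ∈ S, max 1 ‖β‖ ∧
      1 ≤ ‖p.leadingCoeff‖ ^ (2 * S.card - 1) * ∏ β ∈ S, ∏ γ ∈ S.erase β, ‖β - γ‖ := by
  intro p S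
  have hinj : Function.Injective (Int.castRingHom ℂ) := Int.cast_injective
  have hnp : p.natDegree = P.natDegree := natDegree_map_eq_of_injective hinj P
  have hsplit : p.Splits := IsAlgClosed.splits p
  have hnodup : p.roots.Nodup := nodup_roots hsep
  have hSval : S.val = p.roots := by
    change p.roots.toFinset.val = p.roots
    rw [Multiset.toFinset_val, hnodup.dedup]
  have hcard : S.card = P.natDegree := by
    rw [← hnp, hsplit.natDegree_eq_card_roots, ← hSval]; rfl
  have hmem : ∀ β, β ∈ S ↔ β ∈ p.roots := fun β => Multiset.mem_toFinset
  have hlc : p.leadingCoeff = (P.leadingCoeff : ℂ) := by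
    rw [leadingCoeff_map_of_injective hinj]; rfl
  have hP0 : P ≠ 0 := by rintro rfl; simp at hn
  have ha : 1 ≤ ‖p.leadingCoeff‖ := by
    rw [hlc, Complex.norm_intCast]
    exact_mod_cast Int.one_le_abs (leadingCoeff_ne_zero.2 hP0)
  -- products over the multiset of roots are products over `S`
  have hprodS : ∀ F : ℂ → ℝ, (p.roots.map F).prod = ∏ β ∈ S, F β := by
    intro F; rw [Finset.prod_eq_multiset_prod, hSval]
  have hprodSC : ∀ F : ℂ → ℂ, (p.roots.map F).prod = ∏ β ∈ S, F β := by
    intro F; rw [Finset.prod_eq_multiset_prod, hSval]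
  refine ⟨hcard, ha, hmem, ?_, ?_, ?_⟩
  · -- `‖P(ξ)‖ = ‖a‖ ∏ ‖ξ - β‖`
    have : aeval ξ P = p.eval ξ := by rw [aeval_def, eval_map, algebraMap_int_eq]
    rw [this, hsplit.eval_eq_prod_roots, norm_mul, hprodSC, norm_prod]
  · rw [mahlerMeasure_eq_leadingCoeff_mul_prod_roots, hprodS]
  · -- resultant bound
    have h1 := one_le_prod_norm_eval_derivative P hsep
    have hder : ∀ β ∈ S, ‖(derivative p).eval β‖ = ‖p.leadingCoeff‖ * ∏ γ ∈ S.erase β, ‖β - γ‖ := by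
      intro β hβ
      have hβ' : β ∈ p.roots := (hmem β).1 hβ
      have hp : p = C p.leadingCoeff * (p.roots.map (X - C ·)).prod := hsplit.eq_prod_roots
      classical
      have hde : (derivative p).eval β =
          p.leadingCoeff * ((p.roots.erase β).map (β - ·)).prod := by
        conv_lhs => rw [hp]
        rw [derivative_C_mul, eval_mul, eval_C, eval_multiset_prod_X_sub_C_derivative hβ']
      rw [hde, norm_mul]
      congr 1
      rw [Finset.prod_eq_multiset_prod, Finset.erase_val, hSval,
        show ‖((p.roots.erase β).map (β - ·)).prod‖ = normHom (((p.roots.erase β).map (β - ·)).prod)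
          from rfl, map_multiset_prod, Multiset.map_map]
      rfl
    rw [hprodS] at h1
    rw [Finset.prod_congr rfl hder, Finset.prod_mul_distrib, Finset.prod_const] at h1
    calc (1 : ℝ) ≤ _ := h1
      _ = _ := by
        rw [hcard, ← mul_assoc, ← pow_add]
        congr 2
        omega

/-- **Bugeaud, Lemma A.8, (A.25)** (squared form). Let `P` be an integer polynomial of degree
`n ≥ 1` whose image `p` in `ℂ[X]` is separable, `ξ ∈ ℂ` with `‖P(ξ)‖ ≤ 1`, and `α` a root of `p`
at minimal distance from `ξ`. Then for every integer `ℓ ≥ 1`,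
`‖ξ - α‖^{ℓ(ℓ+1)} ≤ 2^{2ℓn} nⁿ M(p)^{2n} ‖P(ξ)‖^{2ℓ}`, i.e. the square of the printed
`|ξ - α|^{ℓ(ℓ+1)/2} ≤ 2^{ℓn} n^{n/2} M(P)ⁿ |P(ξ)|^ℓ`. Proof as printed ((A.26)–(A.30)), with the
resultant `Res(P,P')` for the discriminant and Hadamard's inequality for the Vandermonde
determinant. [cite: Bugeaud2004, Lemma A.8 (A.25)] -/
theorem norm_sub_root_pow_le (P : ℤ[X]) (hn : 0 < P.natDegree)
    (hsep : (P.map (Int.castRingHom ℂ)).Separable) (ξ α : ℂ)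
    (hα : α ∈ (P.map (Int.castRingHom ℂ)).roots)
    (hmin : ∀ β ∈ (P.map (Int.castRingHom ℂ)).roots, ‖ξ - α‖ ≤ ‖ξ - β‖)
    (hsmall : ‖aeval ξ P‖ ≤ 1) (ℓ : ℕ) (hℓ : 1 ≤ ℓ) :
    ‖ξ - α‖ ^ (ℓ * (ℓ + 1)) ≤
      2 ^ (2 * P.natDegree * ℓ) * (P.natDegree : ℝ) ^ P.natDegree *
        (P.map (Int.castRingHom ℂ)).mahlerMeasure ^ (2 * P.natDegree) *
        ‖aeval ξ P‖ ^ (2 * ℓ) := by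
  obtain ⟨hcard, ha, hmem, heval, hM, hD⟩ := roots_data P hn hsep ξ
  set p := P.map (Int.castRingHom ℂ) with hp
  set S := p.roots.toFinset with hS
  set n := P.natDegree with hndef
  set a := p.leadingCoeff with hadef
  set dmin := ‖ξ - α‖ with hdmin
  set Pξ := ‖aeval ξ P‖ with hPξ
  set M := p.mahlerMeasure with hMdef
  have hdmin0 : 0 ≤ dmin := norm_nonneg _
  have hdminS : ∀ β ∈ S, dmin ≤ ‖ξ - β‖ := fun β hβ => hmin β ((hmem β).1 hβ)
  have hαS : α ∈ S := (hmem α).2 hα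
  have ha0 : 0 < ‖a‖ := one_pos.trans_le ha
  have hM1 : 1 ≤ M := by
    rw [hM]
    calc (1 : ℝ) = 1 * 1 := by ring
      _ ≤ ‖a‖ * ∏ β ∈ S, max 1 ‖β‖ := by
        gcongr
        exact Finset.one_le_prod fun β _ => le_max_left _ _
  have hPξ0 : 0 ≤ Pξ := norm_nonneg _
  -- `dmin ^ n ≤ ‖P(ξ)‖`, hence `dmin ≤ 1`
  have hdn : dmin ^ n ≤ Pξ := by
    rw [heval, ← hcard, ← Finset.prod_const]
    calc ∏ _β ∈ S, dmin = 1 * ∏ _β ∈ S, dmin := by ring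
      _ ≤ ‖a‖ * ∏ β ∈ S, ‖ξ - β‖ := by
        gcongr with β hβ
        exact hdminS β hβ
  have hn1 : 1 ≤ n := hn
  have hd1 : dmin ≤ 1 := by
    by_contra h
    push Not at h
    have : 1 < dmin ^ n := one_lt_pow₀ h (by omega)
    linarith
  have hdpow1 : ∀ k : ℕ, dmin ^ k ≤ 1 := fun k => pow_le_one₀ hdmin0 hd1
  -- the three regimes
  by_cases hℓn : ℓ < n
  · -- `ℓ < n`: the core bound, then `m ≤ n`, `M^{2m-1} ≤ M^{2n}`
    have key :=
      core_root_distance_bound S a ξ ha dmin hdmin0 hdminS hD ℓ hℓ (by rw [hcard]; exact hℓn)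
    rw [hcard, ← heval, ← hM] at key
    have h2 : (1 : ℝ) ≤ 2 ^ (ℓ * (ℓ + 1)) := one_le_pow₀ (by norm_num)
    have hmm : ((n - ℓ : ℕ) : ℝ) ^ (n - ℓ) ≤ (n : ℝ) ^ n :=
      (pow_le_pow_left₀ (by positivity) (by exact_mod_cast Nat.sub_le n ℓ) _).trans
        (pow_le_pow_right₀ (by exact_mod_cast hn1) (Nat.sub_le n ℓ))
    have hmid : ((n - ℓ : ℕ) : ℝ) ^ (n - ℓ) * M ^ (2 * (n - ℓ) - 1) ≤ (n : ℝ) ^ n * M ^ (2 * n) :=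
      mul_le_mul hmm (pow_le_pow_right₀ hM1 (by omega)) (by positivity) (by positivity)
    calc dmin ^ (ℓ * (ℓ + 1)) = dmin ^ (ℓ * (ℓ + 1)) * 1 := by ring
      _ ≤ dmin ^ (ℓ * (ℓ + 1)) * 2 ^ (ℓ * (ℓ + 1)) := by gcongr
      _ ≤ _ := key
      _ = 2 ^ (2 * n * ℓ) * (((n - ℓ : ℕ) : ℝ) ^ (n - ℓ) * M ^ (2 * (n - ℓ) - 1)) *
            Pξ ^ (2 * ℓ) := by ring
      _ ≤ 2 ^ (2 * n * ℓ) * ((n : ℝ) ^ n * M ^ (2 * n)) * Pξ ^ (2 * ℓ) :=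
          mul_le_mul_of_nonneg_right (mul_le_mul_of_nonneg_left hmid (by positivity))
            (by positivity)
      _ = _ := by ring
  · push Not at hℓn
    rcases Nat.lt_or_ge 1 n with hn2 | hn2'
    · -- `ℓ ≥ n ≥ 2`: use the core bound with `ℓ' = n - 1`, `m = 1`
      have key := core_root_distance_bound S a ξ ha dmin hdmin0 hdminS hD (n - 1) (by omega)
        (by rw [hcard]; omega)
      rw [hcard, ← heval, ← hM, show n - (n - 1) = 1 by omega, show (2 * 1 - 1 : ℕ) = 1 from rfl,
        pow_one, pow_one, Nat.cast_one, mul_one] at key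
      -- `key : dmin ^ ((n-1) n) * 2 ^ ((n-1) n) ≤ 2 ^ (2 n (n-1)) * M * Pξ ^ (2 (n-1))`
      have key' : dmin ^ ((n - 1) * (n - 1 + 1)) ≤
          2 ^ ((n - 1) * (n - 1 + 1)) * M * Pξ ^ (2 * (n - 1)) := by
        have h2pos : (0 : ℝ) < 2 ^ ((n - 1) * (n - 1 + 1)) := by positivity
        rw [← mul_le_mul_iff_left₀ h2pos]
        calc dmin ^ ((n - 1) * (n - 1 + 1)) * 2 ^ ((n - 1) * (n - 1 + 1))
            ≤ 2 ^ (2 * n * (n - 1)) * M * Pξ ^ (2 * (n - 1)) := key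
          _ = 2 ^ ((n - 1) * (n - 1 + 1)) * M * Pξ ^ (2 * (n - 1)) *
                2 ^ ((n - 1) * (n - 1 + 1)) := by
            rw [mul_comm _ (2 ^ ((n - 1) * (n - 1 + 1)) : ℝ), ← mul_assoc, ← mul_assoc, ← pow_add]
            congr 3
            rw [Nat.sub_add_cancel hn1]; ring
      -- exponent bookkeeping: `ℓ(ℓ+1) = (n-1)n + n·2(ℓ-n+1) + r`
      obtain ⟨k, rfl⟩ := Nat.exists_eq_add_of_le hℓn
      have hexp :
          (n + k) * (n + k + 1) = (n - 1) * (n - 1 + 1) + n * (2 * (k + 1)) + k * (k + 1) := by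
        rcases Nat.exists_eq_add_of_le hn1 with ⟨n', hn'⟩
        rw [hn']
        simp only [Nat.add_sub_cancel_left]
        ring
      calc dmin ^ ((n + k) * (n + k + 1))
          = dmin ^ ((n - 1) * (n - 1 + 1)) * (dmin ^ n) ^ (2 * (k + 1)) * dmin ^ (k * (k + 1)) := by
            rw [hexp, pow_add, pow_add, ← pow_mul]
        _ ≤ 2 ^ ((n - 1) * (n - 1 + 1)) * M * Pξ ^ (2 * (n - 1)) * Pξ ^ (2 * (k + 1)) * 1 := by
            gcongr
            exact hdpow1 _
        _ = 2 ^ ((n - 1) * (n - 1 + 1)) * 1 * M ^ 1 * Pξ ^ (2 * (n + k)) := by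
            rw [mul_one, pow_one, mul_one, mul_assoc, ← pow_add]
            congr 2
            omega
        _ ≤ 2 ^ (2 * n * (n + k)) * (n : ℝ) ^ n * M ^ (2 * n) * Pξ ^ (2 * (n + k)) := by
            have hle1 : (n - 1) * (n - 1 + 1) ≤ 2 * n * (n + k) := by
              calc (n - 1) * (n - 1 + 1) ≤ n * n :=
                    Nat.mul_le_mul (Nat.sub_le n 1) (by omega)
                _ ≤ 2 * n * (n + k) := by nlinarith
            have h2exp : (2 : ℝ) ^ ((n - 1) * (n - 1 + 1)) ≤ 2 ^ (2 * n * (n + k)) :=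
              pow_le_pow_right₀ one_le_two hle1
            have hnn : (1 : ℝ) ≤ (n : ℝ) ^ n := one_le_pow₀ (by exact_mod_cast hn1)
            have hM2n : M ^ 1 ≤ M ^ (2 * n) := pow_le_pow_right₀ hM1 (by omega)
            refine mul_le_mul_of_nonneg_right ?_ (by positivity)
            exact mul_le_mul (mul_le_mul h2exp hnn zero_le_one (by positivity)) hM2n
              (by positivity) (by positivity)
    · -- `n = 1`
      have hn1' : n = 1 := le_antisymm hn2' hn1
      have hexp : ℓ * (ℓ + 1) = 1 * (2 * ℓ) + ℓ * (ℓ - 1) := by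
        rcases Nat.exists_eq_add_of_le hℓ with ⟨k, rfl⟩
        simp only [Nat.add_sub_cancel_left]
        ring
      rw [hn1'] at hdn
      calc dmin ^ (ℓ * (ℓ + 1)) = (dmin ^ 1) ^ (2 * ℓ) * dmin ^ (ℓ * (ℓ - 1)) := by
            rw [hexp, pow_add, pow_mul]
        _ ≤ Pξ ^ (2 * ℓ) * 1 := by
            gcongr
            exact hdpow1 _
        _ = 1 * 1 * 1 * Pξ ^ (2 * ℓ) := by ring
        _ ≤ 2 ^ (2 * n * ℓ) * (n : ℝ) ^ n * M ^ (2 * n) * Pξ ^ (2 * ℓ) := by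
            gcongr
            · exact one_le_pow₀ (by norm_num)
            · exact one_le_pow₀ (by exact_mod_cast hn1)
            · exact one_le_pow₀ hM1

end Literature.NumberTheory.DiophantineApproximation
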